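/-
Copyright (c) 2026 the pub-hodgecm-mathlib formalisation cell (harness21).  Prover seat hodgecm-mathlib-K2E4-p23 (g2), Track B ∕ K2-LIT, h413 =
`stmt-HodgeConjecture-24833`, ENGINE E1, 5Res campaign «ENDGAME BY FAMILIES», ROADCARD §3′ (M2 v2 «SPECTRAL-MEASURE EXHAUSTION»), deal (221) of K2E1-plan (g7): D5′-abs —
the zero–one law for the spectral measure of a vector and the vanishing of its line (continuous) part.  Abstract measure theory ∕ `L²`; Mathlib + ★ D2′ + ★ D1′ currency.
-/
import Summits.HodgeConjecture.HodgeConjecture.Theorems.K2E1ZeroOneMeasureAtom                 -- ★ D2′ (K2E1-p13): `exists_measure_compl_measurableAtom_eq_zero`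
import Summits.HodgeConjecture.HodgeConjecture.Theorems.K2E1CommutantOfMultiplicationFamily   -- ★ D1′ (K2E4-p11): the `M_{𝟙_A}` currency (`memLp_top_indicator`, `[ENNReal.HolderTriple ∞ 2 2]`)
import Mathlib.MeasureTheory.Measure.Trim
import Mathlib.Analysis.Normed.Operator.LinearIsometry
import HarnessLib

/-!
# K2·E1 — `K2E1ZeroOneLawSpectralSupport`: A VECTOR WHOSE SPECTRAL PROJECTIONS ARE ALL `0` OR THE IDENTITY ON IT HAS NO MASS ON THE LINE PART
# (ROADCARD §3′ D5′-abs: «an irreducible has no continuous spectrum» — the `{0,1}`-law ∘ ★ D2′ atom ∘ the line letter)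

Track B ∕ K2-LIT, crux h413 = `stmt-HodgeConjecture-24833`, route of record `HCCMUnconditional`; cell `hodgecm-mathlib`, squad K2, ENGINE E1 (5Res campaign, M2 v2 §3′.1).  Prover seat
`hodgecm-mathlib-K2E4-p23` (g2); deal (221).  THEOREMS ONLY (no `def`, no `instance`, no notation, no named-fact hypothesis, no `sorry`); lane
`--supports stmt-HodgeConjecture-24833 --as helper` (count-neutral).  Pure measure theory ∕ functional analysis — no automorphic object.  CLOSES NO SOCKET.

DESIGN FINDING (vs the (221) wording).  The argument is about ONE VECTOR `w ∈ L²(Ω, m; E)` (E1: `w = U_χ(P_π v)`, the model of a vector of an irreducible `π`): the hypothesis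
«`𝕄_B P_π ∈ {0, P_π}` for all `B ∈ 𝔅`» (E1: `𝕄_B` `G`-equivariant, `π` irreducible) says, vector by vector (`U` injective), **(h01) `∀ B ∈ 𝔅, 𝟙_B • w = 0 ∨ 𝟙_B • w = w`**, and the
conclusion «no continuous component» is `𝟙_Λ • w = 0` for the line part `Λ`.  So the isometry `U`, the projection `Q` and «`range U` reduces `M_{𝟙_B}`» drop out of the abstract head (§3 keeps
the (221) phrasing as a one-line corollary); they matter only for DERIVING (h01) from irreducibility (D5′ proper).

SETTING.  `(Ω, mΩ)` measurable, `m` a measure; a SUB-σ-algebra `𝔅 ≤ mΩ` (E1: generated by the countably many arch-central symbols), COUNTABLY GENERATED; `w : Ω → E`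
(resp. `w ∈ Lp E 2 m`); its spectral measure `ν_w := m.withDensity ‖w‖ₑ²`; the LINE PART `Λ ⊆ Ω` measurable with the LETTER (hline) «every `𝔅`-atom meets `Λ` in an `m`-null set»
(E1 payer: ★ D3 `eq_or_eq_neg_sub_of_forall_rat_archTorusCoeff_eq` — an atom meets each spectral line in ≤ 2 points — × countably many lines × Lebesgue).
* §1 (functions) `withDensity_apply_eq_zero_iff_ae_restrict`, `zero_or_compl_zero_of_ae`, **`exists_measurableAtom_compl_eq_zero`** (HEAD (1): ★ D2′ on `ν_w.trim 𝔅`),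
  **`ae_restrict_eq_zero_of_zero_one`** (HEAD (2): `w = 0` a.e. on `Λ`).
* §2 (`L²`, ★ D1′ currency `𝟙_B • w := (𝟙_B : L∞) • w`, `[ENNReal.HolderTriple ∞ 2 2]`) `indicator_lpSMul_eq_zero_iff`, `indicator_lpSMul_eq_self_iff`,
  **`indicator_lpSMul_eq_zero_of_zero_one`**.
* §3 the (221) phrasing **`indicator_lpSMul_isometry_eq_zero_of_zero_one`** (`U : H →ₗᵢ L²`, `Q : H →L H`, (h01) for the vectors `U (Q v)`).
HONEST LABEL: HC_CM is proved only modulo the 7 printed citations (2 remaining named inputs: hLiu418 = `stmt-HodgeConjecture-24832`, h413 = `stmt-HodgeConjecture-24833`) until rung 0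
closes; this file asserts no named fact and closes no socket; count-neutral.

## References
* [Kallenberg2002] O. Kallenberg, *Foundations of Modern Probability* (2nd ed., 2002), Ch. 1 (atoms of countably generated σ-algebras, zero–one measures).
* [ReedSimonI1980] M. Reed, B. Simon, *Methods of Modern Mathematical Physics I* (1980), §VII.2–VII.3 (spectral measures of a vector, multiplication operators).
* [MoeglinWaldspurger1995] C. Mœglin, J.-L. Waldspurger (1995), IV.3.12 (b), VI.2 (the continuous spectrum carries no irreducible subrepresentation).
-/

set_option autoImplicit false
-- the mandated namespace repeats the single-problem summit's segment (`HodgeConjecture.HodgeConjecture`)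
set_option linter.dupNamespace false

noncomputable section

open MeasureTheory Set Filter
open scoped ENNReal
open Summit.HodgeConjecture.HodgeConjecture.Cruxes.H413.K2E1ZeroOneMeasureAtom (exists_measure_compl_measurableAtom_eq_zero)
open Summit.HodgeConjecture.HodgeConjecture.Cruxes.H413.K2E1CommutantOfMultiplicationFamily (memLp_top_indicator)

namespace Summit.HodgeConjecture.HodgeConjecture.Cruxes.H413.K2E1ZeroOneLawSpectralSupport

/-! ## §1 Functions: the spectral measure `ν_w = m.withDensity ‖w‖ₑ²`, its `{0,1}`-law on `𝔅`, its atom, and the line part -/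

section Functions

variable {Ω : Type*} {𝔅 mΩ : MeasurableSpace Ω} {m : Measure Ω} {E : Type*} [NormedAddCommGroup E]

/-- `ν_w(B) = 0 ↔ w = 0` a.e. on `B` (`B` measurable). [cite: ReedSimonI1980, §VII.2] -/
theorem withDensity_apply_eq_zero_iff_ae_restrict {w : Ω → E} (hw : AEStronglyMeasurable w m) {B : Set Ω} (hB : MeasurableSet B) :
    m.withDensity (fun x => ‖w x‖ₑ ^ 2) B = 0 ↔ w =ᵐ[m.restrict B] 0 := by
  rw [withDensity_apply _ hB, lintegral_eq_zero_iff' ((hw.enorm.pow_const 2).restrict)]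
  refine ⟨fun h => ?_, fun h => ?_⟩
  · filter_upwards [h] with x hx
    simpa [pow_eq_zero_iff, enorm_eq_zero] using hx
  · filter_upwards [h] with x hx
    simp [hx]

/-- **THE `{0,1}`-LAW OF THE SPECTRAL MEASURE**: if for every `B ∈ 𝔅` either `w = 0` a.e. on `B` or `w = 0` a.e. on `Bᶜ`, then `ν_w B = 0 ∨ ν_w Bᶜ = 0` for every `B ∈ 𝔅`.
[cite: ReedSimonI1980, §VII.2] -/
theorem zero_or_compl_zero_of_ae {w : Ω → E} (hw : AEStronglyMeasurable w m) (h𝔅 : 𝔅 ≤ mΩ)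
    (h01 : ∀ B : Set Ω, MeasurableSet[𝔅] B → w =ᵐ[m.restrict B] 0 ∨ w =ᵐ[m.restrict Bᶜ] 0) {B : Set Ω} (hB : MeasurableSet[𝔅] B) :
    m.withDensity (fun x => ‖w x‖ₑ ^ 2) B = 0 ∨ m.withDensity (fun x => ‖w x‖ₑ ^ 2) Bᶜ = 0 := by
  rcases h01 B hB with h | h
  · exact Or.inl ((withDensity_apply_eq_zero_iff_ae_restrict hw (h𝔅 B hB)).2 h)
  · exact Or.inr ((withDensity_apply_eq_zero_iff_ae_restrict hw (h𝔅 B hB).compl).2 h)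

/-- **HEAD (1): THE SPECTRAL MEASURE OF `w` IS CARRIED BY ONE `𝔅`-ATOM** (`𝔅` countably generated, `w ≠ 0`): ★ D2′ `exists_measure_compl_measurableAtom_eq_zero` applied to the trimmed
measure `ν_w|_𝔅`. [cite: Kallenberg2002, Ch. 1] [cite: ReedSimonI1980, §VII.2] -/
theorem exists_measurableAtom_compl_eq_zero {w : Ω → E} (hw : AEStronglyMeasurable w m) (h𝔅 : 𝔅 ≤ mΩ)
    (h𝔅c : @MeasurableSpace.CountablyGenerated Ω 𝔅)
    (h01 : ∀ B : Set Ω, MeasurableSet[𝔅] B → w =ᵐ[m.restrict B] 0 ∨ w =ᵐ[m.restrict Bᶜ] 0) (h0 : ¬ w =ᵐ[m] 0) :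
    ∃ ω : Ω, m.withDensity (fun x => ‖w x‖ₑ ^ 2) (@measurableAtom Ω 𝔅 ω)ᶜ = 0 := by
  set ν : Measure Ω := m.withDensity (fun x => ‖w x‖ₑ ^ 2) with hν
  have h01' : ∀ s : Set Ω, MeasurableSet[𝔅] s → ν.trim h𝔅 s = 0 ∨ ν.trim h𝔅 sᶜ = 0 := fun s hs => by
    rw [trim_measurableSet_eq h𝔅 hs, trim_measurableSet_eq h𝔅 hs.compl]
    exact zero_or_compl_zero_of_ae hw h𝔅 h01 hs
  have huniv : ν.trim h𝔅 univ ≠ 0 := by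
    rw [trim_measurableSet_eq h𝔅 MeasurableSet.univ]
    intro h
    apply h0
    have h' := (withDensity_apply_eq_zero_iff_ae_restrict hw MeasurableSet.univ).1 h
    rwa [Measure.restrict_univ] at h'
  obtain ⟨ω, hω⟩ := @exists_measure_compl_measurableAtom_eq_zero Ω 𝔅 h𝔅c (ν.trim h𝔅) h01' huniv
  refine ⟨ω, ?_⟩
  rwa [trim_measurableSet_eq h𝔅 (@MeasurableSpace.measurableSet_measurableAtom Ω 𝔅 h𝔅c ω).compl] at hω

/-- **HEAD (2): THE LINE PART OF `w` VANISHES.**  Under the `{0,1}`-law on a countably generated `𝔅` and the LINE LETTER «every `𝔅`-atom meets `Λ` in an `m`-null set», `w = 0`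
a.e. on `Λ` — `ν_w ≪ m` kills `Λ ∩ atom`, the atom kills its complement. [cite: ReedSimonI1980, §VII.2] [cite: MoeglinWaldspurger1995, IV.3.12] -/
theorem ae_restrict_eq_zero_of_zero_one {w : Ω → E} (hw : AEStronglyMeasurable w m) (h𝔅 : 𝔅 ≤ mΩ)
    (h𝔅c : @MeasurableSpace.CountablyGenerated Ω 𝔅)
    (h01 : ∀ B : Set Ω, MeasurableSet[𝔅] B → w =ᵐ[m.restrict B] 0 ∨ w =ᵐ[m.restrict Bᶜ] 0)
    {Λ : Set Ω} (hΛ : MeasurableSet Λ) (hline : ∀ ω : Ω, m (Λ ∩ @measurableAtom Ω 𝔅 ω) = 0) :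
    w =ᵐ[m.restrict Λ] 0 := by
  by_cases h0 : w =ᵐ[m] 0
  · exact ae_restrict_of_ae h0
  obtain ⟨ω, hω⟩ := exists_measurableAtom_compl_eq_zero hw h𝔅 h𝔅c h01 h0
  refine (withDensity_apply_eq_zero_iff_ae_restrict hw hΛ).1 (le_antisymm ?_ bot_le)
  have hsub : Λ ⊆ (Λ ∩ @measurableAtom Ω 𝔅 ω) ∪ (@measurableAtom Ω 𝔅 ω)ᶜ := fun x hx => by
    by_cases hA : x ∈ @measurableAtom Ω 𝔅 ω
    · exact Or.inl ⟨hx, hA⟩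
    · exact Or.inr hA
  calc m.withDensity (fun x => ‖w x‖ₑ ^ 2) Λ
      ≤ m.withDensity (fun x => ‖w x‖ₑ ^ 2) (Λ ∩ @measurableAtom Ω 𝔅 ω) + m.withDensity (fun x => ‖w x‖ₑ ^ 2) (@measurableAtom Ω 𝔅 ω)ᶜ :=
        (measure_mono hsub).trans (measure_union_le _ _)
    _ = 0 := by rw [hω, add_zero, withDensity_absolutelyContinuous m _ (hline ω)]

end Functions

/-! ## §2 The `L²` edition in the multiplication-operator currency `𝟙_B • w` -/

section L2

variable {Ω : Type*} {𝔅 mΩ : MeasurableSpace Ω} {m : Measure Ω} {𝕜 : Type*} [RCLike 𝕜] {E : Type*} [NormedAddCommGroup E] [NormedSpace 𝕜 E]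
variable [ENNReal.HolderTriple ∞ 2 2]

/-- `𝟙_B • w = 0 ↔ w = 0` a.e. on `B`. [cite: ReedSimonI1980, §VII.2] -/
theorem indicator_lpSMul_eq_zero_iff (w : Lp E 2 m) {B : Set Ω} (hB : MeasurableSet B) (h : MemLp (B.indicator fun _ : Ω => (1 : 𝕜)) ∞ m) :
    (h.toLp (B.indicator fun _ : Ω => (1 : 𝕜)) • w : Lp E 2 m) = 0 ↔ (w : Ω → E) =ᵐ[m.restrict B] 0 := by
  rw [Lp.eq_zero_iff_ae_eq_zero, ae_eq_restrict_iff_indicator_ae_eq hB, Set.indicator_zero']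
  have hsm : ((h.toLp (B.indicator fun _ : Ω => (1 : 𝕜)) • w : Lp E 2 m) : Ω → E) =ᵐ[m] B.indicator (w : Ω → E) := by
    filter_upwards [Lp.coeFn_lpSMul (r := 2) (h.toLp (B.indicator fun _ : Ω => (1 : 𝕜))) w, h.coeFn_toLp] with x hx hx1
    classical
    rw [hx, Pi.smul_apply', hx1, Set.indicator_apply, Set.indicator_apply]
    split_ifs <;> simp
  exact ⟨fun h0 => hsm.symm.trans h0, fun h0 => hsm.trans h0⟩

/-- `𝟙_B • w = w ↔ w = 0` a.e. on `Bᶜ`. [cite: ReedSimonI1980, §VII.2] -/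
theorem indicator_lpSMul_eq_self_iff (w : Lp E 2 m) {B : Set Ω} (hB : MeasurableSet B) (h : MemLp (B.indicator fun _ : Ω => (1 : 𝕜)) ∞ m) :
    (h.toLp (B.indicator fun _ : Ω => (1 : 𝕜)) • w : Lp E 2 m) = w ↔ (w : Ω → E) =ᵐ[m.restrict Bᶜ] 0 := by
  rw [ae_eq_restrict_iff_indicator_ae_eq hB.compl, Set.indicator_zero', Lp.ext_iff]
  have hsm : ((h.toLp (B.indicator fun _ : Ω => (1 : 𝕜)) • w : Lp E 2 m) : Ω → E) =ᵐ[m] B.indicator (w : Ω → E) := by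
    filter_upwards [Lp.coeFn_lpSMul (r := 2) (h.toLp (B.indicator fun _ : Ω => (1 : 𝕜))) w, h.coeFn_toLp] with x hx hx1
    classical
    rw [hx, Pi.smul_apply', hx1, Set.indicator_apply, Set.indicator_apply]
    split_ifs <;> simp
  have hkey : B.indicator (w : Ω → E) =ᵐ[m] (w : Ω → E) ↔ Bᶜ.indicator (w : Ω → E) =ᵐ[m] 0 := by
    refine ⟨fun h0 => ?_, fun h0 => ?_⟩
    · filter_upwards [h0] with x hx
      have h1 := congrFun (B.indicator_self_add_compl (w : Ω → E)) x
      rw [Pi.add_apply, hx] at h1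
      simpa using h1
    · filter_upwards [h0] with x hx
      have h1 := congrFun (B.indicator_self_add_compl (w : Ω → E)) x
      rw [Pi.add_apply, hx, Pi.zero_apply, add_zero] at h1
      exact h1
  exact ⟨fun h0 => hkey.1 (hsm.symm.trans h0), fun h0 => hsm.trans (hkey.2 h0)⟩

/-- **`L²` HEAD: NO MASS ON THE LINE PART.**  For `w ∈ L²(Ω; E)` with `𝟙_B • w ∈ {0, w}` for every `B` of a countably generated sub-σ-algebra `𝔅`, and a measurable line part `Λ` meeting
every `𝔅`-atom in an `m`-null set: **`𝟙_Λ • w = 0`**. [cite: ReedSimonI1980, §VII.3] [cite: MoeglinWaldspurger1995, IV.3.12] -/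
theorem indicator_lpSMul_eq_zero_of_zero_one (w : Lp E 2 m) (h𝔅 : 𝔅 ≤ mΩ) (h𝔅c : @MeasurableSpace.CountablyGenerated Ω 𝔅)
    (h01 : ∀ B : Set Ω, ∀ hB : MeasurableSet[𝔅] B,
      ((memLp_top_indicator (𝕜 := 𝕜) (m := m) (h𝔅 B hB)).toLp (B.indicator fun _ : Ω => (1 : 𝕜)) • w : Lp E 2 m) = 0 ∨
      ((memLp_top_indicator (𝕜 := 𝕜) (m := m) (h𝔅 B hB)).toLp (B.indicator fun _ : Ω => (1 : 𝕜)) • w : Lp E 2 m) = w)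
    {Λ : Set Ω} (hΛ : MeasurableSet Λ) (hline : ∀ ω : Ω, m (Λ ∩ @measurableAtom Ω 𝔅 ω) = 0) (hΛ1 : MemLp (Λ.indicator fun _ : Ω => (1 : 𝕜)) ∞ m) :
    (hΛ1.toLp (Λ.indicator fun _ : Ω => (1 : 𝕜)) • w : Lp E 2 m) = 0 := by
  rw [indicator_lpSMul_eq_zero_iff w hΛ hΛ1]
  refine ae_restrict_eq_zero_of_zero_one (Lp.aestronglyMeasurable w) h𝔅 h𝔅c (fun B hB => ?_) hΛ hline
  rcases h01 B hB with h | h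
  · exact Or.inl ((indicator_lpSMul_eq_zero_iff w (h𝔅 B hB) _).1 h)
  · exact Or.inr ((indicator_lpSMul_eq_self_iff w (h𝔅 B hB) _).1 h)

end L2

/-! ## §3 The (221) phrasing: vectors of a reducing block `Q` through an isometry `U` -/

section Isometry

variable {Ω : Type*} {𝔅 mΩ : MeasurableSpace Ω} {m : Measure Ω} {E : Type*} [NormedAddCommGroup E] [InnerProductSpace ℂ E]
  {H : Type*} [NormedAddCommGroup H] [InnerProductSpace ℂ H]
variable [ENNReal.HolderTriple ∞ 2 2]

/-- **«AN IRREDUCIBLE HAS NO CONTINUOUS SPECTRUM» (abstract shape of ROADCARD §3′.1).**  `U : H →ₗᵢ L²(Ω; E)` an isometry (E1: the Plancherel isometry of a family), `Q : H →L H`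
(E1: the projection onto an irreducible `π`), and for every `B` of the countably generated symbol σ-algebra `𝔅` the dichotomy «`𝟙_B • U(Qv) = 0` for all `v`, OR `= U(Qv)` for all `v`»
(E1: `𝕄_B P_π` is a `G`-equivariant map into `π`, so its closed range is `0` or `π`); THEN `𝟙_Λ • U(Qv) = 0` for every `v` and every measurable line part `Λ` meeting the `𝔅`-atoms in null
sets (★ D3: ≤ 2 points per line). [cite: MoeglinWaldspurger1995, IV.3.12, VI.2] [cite: ReedSimonI1980, §VII.3] -/
theorem indicator_lpSMul_isometry_eq_zero_of_zero_one (U : H →ₗᵢ[ℂ] Lp E 2 m) (Q : H →L[ℂ] H) (h𝔅 : 𝔅 ≤ mΩ)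
    (h𝔅c : @MeasurableSpace.CountablyGenerated Ω 𝔅)
    (h01 : ∀ B : Set Ω, ∀ hB : MeasurableSet[𝔅] B,
      (∀ v : H, ((memLp_top_indicator (𝕜 := ℂ) (m := m) (h𝔅 B hB)).toLp (B.indicator fun _ : Ω => (1 : ℂ)) • U (Q v) : Lp E 2 m) = 0) ∨
      (∀ v : H, ((memLp_top_indicator (𝕜 := ℂ) (m := m) (h𝔅 B hB)).toLp (B.indicator fun _ : Ω => (1 : ℂ)) • U (Q v) : Lp E 2 m) = U (Q v)))
    {Λ : Set Ω} (hΛ : MeasurableSet Λ) (hline : ∀ ω : Ω, m (Λ ∩ @measurableAtom Ω 𝔅 ω) = 0) (hΛ1 : MemLp (Λ.indicator fun _ : Ω => (1 : ℂ)) ∞ m) (v : H) :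
    (hΛ1.toLp (Λ.indicator fun _ : Ω => (1 : ℂ)) • U (Q v) : Lp E 2 m) = 0 :=
  indicator_lpSMul_eq_zero_of_zero_one (U (Q v)) h𝔅 h𝔅c (fun B hB => (h01 B hB).imp (fun h => h v) (fun h => h v)) hΛ hline hΛ1

end Isometry

end Summit.HodgeConjecture.HodgeConjecture.Cruxes.H413.K2E1ZeroOneLawSpectralSupport

end
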